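import Mathlib
import Literature.NumberTheory.Transcendental.KZIdealTetrahedron
import Literature.NumberTheory.Transcendental.IdealTetrahedronSlices
import Literature.NumberTheory.Transcendental.KZCalculusProofs
import Literature.NumberTheory.Transcendental.KZHomotopyMoves
import Literature.NumberTheory.Transcendental.KZSemiCanonicalReductionProofs
import Literature.NumberTheory.Transcendental.SemialgebraicMapsProofs

/-!
# `OffTetraSectorKernel`, line `flat-shadow`: the descent move (rule 3)

Stub `stub_descend` of the crux `OffTetraSectorKernel` (stmt-KontsevichZagierPeriods-10557, route
HyperbolicBloch). Coordinates on `ℝ³`: `p 0 = x`, `p 1 = y`, `p 2 = s` (the inverted height `s = 1/t`).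
For algebraic `z = a + ib`, `b > 0`: `Δ(z) = {0 < q₁, a q₁ < b q₀, b (q₀ − 1) < (a − 1) q₁}` is the open
triangle `(0, 1, z)`; `pw(q) = b (q₀ − q₀² − q₁²) + (|z|² − a) q₁` (`b` times minus the power of `q`
w.r.t. the circumcircle of `0, 1, z`) is POSITIVE on `Δ(z)` (tree: `mul_height_pos`); `S(z) =
{init p ∈ Δ(z), 0 < s, pw·s² < b}` is the image of the ideal tetrahedron under `t ↦ 1/t` (stub
`stub_invert`), an open solid with fibres `0 < s < β(q) := (b / pw(q))^{1/2}`; `φ = b/(2 pw)` is the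
FLAT DENSITY. We prove: every representation `[S(z), s]` is KZ-equivalent to every `[Δ(z), φ]`, and one
such exists. Moves: (1) `[S(z), s] − [band, s] ∈ relations`, `band = {init p ∈ Δ(z), 0 ≤ s ≤ β}` the
CLOSED band — the domains differ by the null graphs `s = 0`, `s = β` (rule (1):
`KZ.of_sub_of_mem_relations_of_null`, `KZ.volume_graph_eq_zero`); (2) `[band, s] − [Δ(z), F(·,β) − F(·,0)]
∈ relations` — ONE Newton–Leibniz move along the last coordinate with the POLYNOMIAL primitive
`F = s²/2` and `ℚ`-semialgebraic fibre bounds (`KZ.exists_band_newtonLeibniz`, the tree's packaged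
rule (3)); (3) `F(q, β q) − F(q, 0) = b/(2 pw) = φ q` (congruence, rule (1)). Integrability of `φ` on
`Δ(z)` comes by Fubini from that of `s` on `S(z)` (`∫₀^β s ds = φ`;
`MeasureTheory.Integrable.integral_prod_right`).

References: M. Kontsevich, D. Zagier, *Periods* (2001), §1.2 rules (1), (3); J. Milnor, *Hyperbolic
geometry: the first 150 years* (1982), Appendix, proof of Lemma 2; J. Bochnak, M. Coste, M.-F. Roy,
*Real Algebraic Geometry* (1998), §2.2.
-/

noncomputable section

open Set MeasureTheory MvPolynomial
open Literature.NumberTheory.Transcendental Literature.ModelTheory.ExponentialFields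

namespace Summit.KontsevichZagierPeriods.HyperbolicBloch.OffTetraSectorKernel

/-- **The hemisphere lies above the open triangle**: `pw(q) > 0` for `q ∈ Δ(z)` (`Im z > 0`).
[cite: Milnor1982, Appendix, proof of Lemma 2] -/
theorem descend_pw_pos {z : ℂ} (him : 0 < z.im) {q : Fin 2 → ℝ} (h1 : 0 < q 1)
    (h2 : z.re * q 1 < z.im * q 0) (h3 : z.im * (q 0 - 1) < (z.re - 1) * q 1) :
    0 < z.im * (q 0 - q 0 ^ 2 - q 1 ^ 2) + (Complex.normSq z - z.re) * q 1 := by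
  have h := mul_height_pos him h1 h2.le h3.le (lt_of_mem_triangle h2 h3)
  rw [Complex.normSq_apply]
  nlinarith [h]

/-- For `s ≥ 0` and `pw > 0`: `pw · s² < b ↔ s < (b/pw)^{1/2}`. [folklore] -/
theorem descend_lt_sqrt_iff {b pw s : ℝ} (hpw : 0 < pw) (hs : 0 ≤ s) :
    pw * s ^ 2 < b ↔ s < Real.sqrt (b / pw) := by
  rw [Real.lt_sqrt hs, lt_div_iff₀ hpw, mul_comm]

/-- For `s ≥ 0` and `pw > 0`: `b ≤ pw · s² ↔ (b/pw)^{1/2} ≤ s`. [folklore] -/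
theorem descend_sqrt_le_iff {b pw s : ℝ} (hpw : 0 < pw) (hs : 0 ≤ s) :
    b ≤ pw * s ^ 2 ↔ Real.sqrt (b / pw) ≤ s := by
  rw [← not_lt, descend_lt_sqrt_iff hpw hs, not_lt]

/-- The open triangle `Δ(z)` is `ℚ`-semialgebraic for algebraic `z` (three strict inequalities between
`ℚ`-semialgebraic functions with real-algebraic coefficients). [cite: KontsevichZagier2001, §1.1] -/
theorem descend_isSemialgebraic_triangle {z : ℂ} (hz : IsAlgebraic ℚ z) :
    IsSemialgebraic ℚ {q : Fin 2 → ℝ | 0 < q 1 ∧ z.re * q 1 < z.im * q 0 ∧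
      z.im * (q 0 - 1) < (z.re - 1) * q 1} := by
  obtain ⟨hre, him⟩ := isAlgebraic_re_im hz
  have hU : IsSemialgebraic ℚ (univ : Set (Fin 2 → ℝ)) := isSemialgebraic_univ
  have hc : ∀ i : Fin 2, IsSemialgebraicFunOn ℚ (univ : Set (Fin 2 → ℝ)) (fun p => p i) :=
    fun i => (isSemialgebraicFunOn_aeval hU (X i)).congr fun p _ => by simp
  have ha : IsSemialgebraicFunOn ℚ (univ : Set (Fin 2 → ℝ)) (fun _ => z.re) :=
    isSemialgebraicFunOn_const_of_isAlgebraic hU hre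
  have hb : IsSemialgebraicFunOn ℚ (univ : Set (Fin 2 → ℝ)) (fun _ => z.im) :=
    isSemialgebraicFunOn_const_of_isAlgebraic hU him
  have h0 : IsSemialgebraicFunOn ℚ (univ : Set (Fin 2 → ℝ)) (fun _ => (0 : ℝ)) := by
    simpa using isSemialgebraicFunOn_natCast (k := ℚ) (R := ℝ) hU 0
  have h1 : IsSemialgebraicFunOn ℚ (univ : Set (Fin 2 → ℝ)) (fun _ => (1 : ℝ)) := by
    simpa using isSemialgebraicFunOn_natCast (k := ℚ) (R := ℝ) hU 1
  have S1 : IsSemialgebraic ℚ {q : Fin 2 → ℝ | 0 < q 1} :=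
    isSemialgebraic_setOf_lt_of_isSemialgebraicFunOn h0 (hc 1)
  have S2 : IsSemialgebraic ℚ {q : Fin 2 → ℝ | z.re * q 1 < z.im * q 0} :=
    isSemialgebraic_setOf_lt_of_isSemialgebraicFunOn (IsSemialgebraicFunOn.mul_holds ha (hc 1))
      (IsSemialgebraicFunOn.mul_holds hb (hc 0))
  have S3 : IsSemialgebraic ℚ {q : Fin 2 → ℝ | z.im * (q 0 - 1) < (z.re - 1) * q 1} :=
    isSemialgebraic_setOf_lt_of_isSemialgebraicFunOn
      (IsSemialgebraicFunOn.mul_holds hb (IsSemialgebraicFunOn.sub_holds (hc 0) h1))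
      (IsSemialgebraicFunOn.mul_holds (IsSemialgebraicFunOn.sub_holds ha h1) (hc 1))
  have : {q : Fin 2 → ℝ | 0 < q 1 ∧ z.re * q 1 < z.im * q 0 ∧ z.im * (q 0 - 1) < (z.re - 1) * q 1} =
      {q : Fin 2 → ℝ | 0 < q 1} ∩ ({q | z.re * q 1 < z.im * q 0} ∩
        {q | z.im * (q 0 - 1) < (z.re - 1) * q 1}) := by
    ext q; simp
  rw [this]
  exact S1.inter (S2.inter S3)

/-- `pw` is a `ℚ`-semialgebraic function on any `ℚ`-semialgebraic `σ ⊆ ℝ²` (a polynomial with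
real-algebraic coefficients). [cite: KontsevichZagier2001, §1.1] -/
theorem descend_isSemialgebraicFunOn_pw {z : ℂ} (hz : IsAlgebraic ℚ z) {σ : Set (Fin 2 → ℝ)}
    (hσ : IsSemialgebraic ℚ σ) :
    IsSemialgebraicFunOn ℚ σ
      (fun q => z.im * (q 0 - q 0 ^ 2 - q 1 ^ 2) + (Complex.normSq z - z.re) * q 1) := by
  obtain ⟨hre, him⟩ := isAlgebraic_re_im hz
  have hc : ∀ i : Fin 2, IsSemialgebraicFunOn ℚ σ (fun p => p i) :=
    fun i => (isSemialgebraicFunOn_aeval hσ (X i)).congr fun p _ => by simp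
  have hb : IsSemialgebraicFunOn ℚ σ (fun _ => z.im) := isSemialgebraicFunOn_const_of_isAlgebraic hσ him
  have hN : IsSemialgebraicFunOn ℚ σ (fun _ => Complex.normSq z - z.re) := by
    have h : IsAlgebraic ℚ (Complex.normSq z - z.re) := by
      rw [Complex.normSq_apply]
      exact ((hre.mul hre).add (him.mul him)).sub hre
    exact isSemialgebraicFunOn_const_of_isAlgebraic hσ h
  have hP : IsSemialgebraicFunOn ℚ σ (fun q => q 0 - q 0 ^ 2 - q 1 ^ 2) :=
    (isSemialgebraicFunOn_aeval hσ (X 0 - X 0 ^ 2 - X 1 ^ 2)).congr fun p _ => by simp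
  exact IsSemialgebraicFunOn.add_holds (IsSemialgebraicFunOn.mul_holds hb hP)
    (IsSemialgebraicFunOn.mul_holds hN (hc 1))

/-- The flat density `φ = b/(2 pw)` is a `ℚ`-semialgebraic function on the triangle (where `pw > 0`).
[cite: KontsevichZagier2001, §1.1] -/
theorem descend_isSemialgebraicFunOn_phi {z : ℂ} (hz : IsAlgebraic ℚ z) (him : 0 < z.im)
    {σ : Set (Fin 2 → ℝ)} (hσ : IsSemialgebraic ℚ σ)
    (hσΔ : σ ⊆ {q : Fin 2 → ℝ | 0 < q 1 ∧ z.re * q 1 < z.im * q 0 ∧ z.im * (q 0 - 1) < (z.re - 1) * q 1}) :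
    IsSemialgebraicFunOn ℚ σ (fun q => z.im /
      (2 * (z.im * (q 0 - q 0 ^ 2 - q 1 ^ 2) + (Complex.normSq z - z.re) * q 1))) := by
  have hb : IsSemialgebraicFunOn ℚ σ (fun _ => z.im) :=
    isSemialgebraicFunOn_const_of_isAlgebraic hσ (isAlgebraic_re_im hz).2
  have h2 : IsSemialgebraicFunOn ℚ σ (fun _ => (2 : ℝ)) := by
    simpa using isSemialgebraicFunOn_natCast (k := ℚ) (R := ℝ) hσ 2
  have hden := IsSemialgebraicFunOn.mul_holds h2 (descend_isSemialgebraicFunOn_pw hz hσ)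
  refine (IsSemialgebraicFunOn.div hb hden fun q hq => ?_).congr fun q _ => by simp
  have := descend_pw_pos him (hσΔ hq).1 (hσΔ hq).2.1 (hσΔ hq).2.2
  simp only [Pi.mul_apply]
  positivity

/-- The fibre bound `β = (b/pw)^{1/2}` is a `ℚ`-semialgebraic function on the triangle (square root of
a positive `ℚ`-semialgebraic function; Tarski–Seidenberg). [cite: BochnakCosteRoy1998, §2.2] -/
theorem descend_isSemialgebraicFunOn_beta {z : ℂ} (hz : IsAlgebraic ℚ z) (him : 0 < z.im)
    {σ : Set (Fin 2 → ℝ)} (hσ : IsSemialgebraic ℚ σ)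
    (hσΔ : σ ⊆ {q : Fin 2 → ℝ | 0 < q 1 ∧ z.re * q 1 < z.im * q 0 ∧ z.im * (q 0 - 1) < (z.re - 1) * q 1}) :
    IsSemialgebraicFunOn ℚ σ (fun q => Real.sqrt (z.im /
      (z.im * (q 0 - q 0 ^ 2 - q 1 ^ 2) + (Complex.normSq z - z.re) * q 1))) := by
  have hb : IsSemialgebraicFunOn ℚ σ (fun _ => z.im) :=
    isSemialgebraicFunOn_const_of_isAlgebraic hσ (isAlgebraic_re_im hz).2
  have hden := descend_isSemialgebraicFunOn_pw hz hσ
  have hq : IsSemialgebraicFunOn ℚ σ (fun q => z.im /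
      (z.im * (q 0 - q 0 ^ 2 - q 1 ^ 2) + (Complex.normSq z - z.re) * q 1)) :=
    (IsSemialgebraicFunOn.div hb hden fun q hq =>
      (descend_pw_pos him (hσΔ hq).1 (hσΔ hq).2.1 (hσΔ hq).2.2).ne').congr fun q _ => by simp
  exact IsSemialgebraicFunOn.sqrt_holds hq


/-- Coordinates of `Fin.snoc x t : ℝ³`. [folklore] -/
@[simp] theorem descend_snoc_zero (x : Fin 2 → ℝ) (t : ℝ) : (Fin.snoc x t : Fin 3 → ℝ) 0 = x 0 := rfl

/-- Coordinates of `Fin.snoc x t : ℝ³`. [folklore] -/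
@[simp] theorem descend_snoc_one (x : Fin 2 → ℝ) (t : ℝ) : (Fin.snoc x t : Fin 3 → ℝ) 1 = x 1 := rfl

/-- Coordinates of `Fin.snoc x t : ℝ³`. [folklore] -/
@[simp] theorem descend_snoc_two (x : Fin 2 → ℝ) (t : ℝ) : (Fin.snoc x t : Fin 3 → ℝ) 2 = t := rfl

/-- **Fubini for the last coordinate**: the fibre integrals of an integrable function on `ℝⁿ⁺¹` form an
integrable function on `ℝⁿ` (`MeasureTheory.Integrable.integral_prod_right` transported along the
volume-preserving `MeasurableEquiv.piFinSuccAbove _ (Fin.last n)`). [folklore] -/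
theorem descend_integrable_integral_snoc {n : ℕ} {G : (Fin (n + 1) → ℝ) → ℝ} (hG : Integrable G) :
    Integrable (fun x : Fin n → ℝ => ∫ t : ℝ, G (Fin.snoc x t)) := by
  set e : (Fin (n + 1) → ℝ) ≃ᵐ ℝ × (Fin n → ℝ) :=
    MeasurableEquiv.piFinSuccAbove (fun _ => ℝ) (Fin.last n) with he_def
  have he : MeasurePreserving e volume volume :=
    volume_preserving_piFinSuccAbove (fun _ => ℝ) (Fin.last n)
  have he_symm : ∀ p : ℝ × (Fin n → ℝ), e.symm p = Fin.snoc p.2 p.1 := fun p => by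
    simp [he_def, MeasurableEquiv.piFinSuccAbove, Fin.snocEquiv]
  have hG2 : Integrable (fun p : ℝ × (Fin n → ℝ) => G (Fin.snoc p.2 p.1))
      ((volume : Measure ℝ).prod (volume : Measure (Fin n → ℝ))) := by
    have h := ((he.symm e).integrable_comp_emb e.symm.measurableEmbedding (g := G)).mpr hG
    rw [← Measure.volume_eq_prod]
    convert h using 1
    ext p
    simp [he_symm]
  exact hG2.integral_prod_right

/-- `∫_{(0, β)} t dt = β²/2` for `β ≥ 0`. [folklore] -/
theorem descend_integral_Ioo_id {β : ℝ} (hβ : 0 ≤ β) : ∫ t in Ioo 0 β, t = β ^ 2 / 2 := by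
  rw [← integral_Ioc_eq_integral_Ioo, ← intervalIntegral.integral_of_le hβ, integral_id]
  ring

/-- **Integrability of the flat density** `φ = b/(2 pw)` on the triangle, by Fubini from the
integrability of `s` on the open solid `S(z)`: over `q ∈ Δ(z)` the fibre of `S(z)` is the interval
`(0, β(q))`, `β = (b/pw)^{1/2}`, and `∫₀^β s ds = β²/2 = φ(q)`. [cite: Milnor1982, Appendix, Lemma 2] -/
theorem descend_integrableOn_phi {z : ℂ} (him : 0 < z.im) (m : KZ.IntegralRep 3)
    (hm : m.domain = {p | 0 < p 1 ∧ z.re * p 1 < z.im * p 0 ∧ z.im * (p 0 - 1) < (z.re - 1) * p 1 ∧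
      0 < p 2 ∧ (z.im * (p 0 - p 0 ^ 2 - p 1 ^ 2) + (Complex.normSq z - z.re) * p 1) * p 2 ^ 2 < z.im})
    (hmi : EqOn m.integrand (fun p => p 2) m.domain) :
    IntegrableOn (fun q => z.im / (2 * (z.im * (q 0 - q 0 ^ 2 - q 1 ^ 2) + (Complex.normSq z - z.re) * q 1)))
      {q : Fin 2 → ℝ | 0 < q 1 ∧ z.re * q 1 < z.im * q 0 ∧ z.im * (q 0 - 1) < (z.re - 1) * q 1} := by
  set T : Set (Fin 2 → ℝ) :=
    {q | 0 < q 1 ∧ z.re * q 1 < z.im * q 0 ∧ z.im * (q 0 - 1) < (z.re - 1) * q 1} with hT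
  set pw : (Fin 2 → ℝ) → ℝ :=
    fun q => z.im * (q 0 - q 0 ^ 2 - q 1 ^ 2) + (Complex.normSq z - z.re) * q 1 with hpw
  set β : (Fin 2 → ℝ) → ℝ := fun q => Real.sqrt (z.im / pw q) with hβ
  have hbm : MeasurableSet m.domain := KZ.IntegralRep.measurableSet_domain_holds m
  have hTm : MeasurableSet T := by
    rw [hT]
    have : {q : Fin 2 → ℝ | 0 < q 1 ∧ z.re * q 1 < z.im * q 0 ∧ z.im * (q 0 - 1) < (z.re - 1) * q 1} =
        {q : Fin 2 → ℝ | 0 < q 1} ∩ ({q | z.re * q 1 < z.im * q 0} ∩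
          {q | z.im * (q 0 - 1) < (z.re - 1) * q 1}) := by
      ext q; simp
    rw [this]
    refine (isOpen_lt ?_ ?_).measurableSet.inter ((isOpen_lt ?_ ?_).measurableSet.inter
      (isOpen_lt ?_ ?_).measurableSet) <;> fun_prop
  -- the integrand extended by zero, and its fibres
  set G : (Fin 3 → ℝ) → ℝ := m.domain.indicator m.integrand with hG_def
  have hG : Integrable G := (integrable_indicator_iff hbm).mpr m.integrableOn
  have hmem : ∀ (x : Fin 2 → ℝ) (t : ℝ), (Fin.snoc x t : Fin 3 → ℝ) ∈ m.domain ↔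
      x ∈ T ∧ 0 < t ∧ pw x * t ^ 2 < z.im := by
    intro x t
    rw [hm, hT]
    simp only [mem_setOf_eq, descend_snoc_zero, descend_snoc_one, descend_snoc_two, hpw]
    tauto
  have hfib_in : ∀ x ∈ T, (fun t => G (Fin.snoc x t)) = (Ioo 0 (β x)).indicator fun t => t := by
    intro x hx
    have hpx : 0 < pw x := descend_pw_pos him hx.1 hx.2.1 hx.2.2
    ext t
    by_cases ht : t ∈ Ioo 0 (β x)
    · have hxt : (Fin.snoc x t : Fin 3 → ℝ) ∈ m.domain :=
        (hmem x t).2 ⟨hx, ht.1, (descend_lt_sqrt_iff hpx ht.1.le).2 ht.2⟩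
      rw [Set.indicator_of_mem ht, hG_def, Set.indicator_of_mem hxt, hmi hxt]
      rfl
    · have hxt : (Fin.snoc x t : Fin 3 → ℝ) ∉ m.domain := fun h => by
        obtain ⟨-, ht0, hlt⟩ := (hmem x t).1 h
        exact ht ⟨ht0, (descend_lt_sqrt_iff hpx ht0.le).1 hlt⟩
      rw [Set.indicator_of_notMem ht, hG_def, Set.indicator_of_notMem hxt]
  have hfib_out : ∀ x ∉ T, (fun t => G (Fin.snoc x t)) = fun _ => 0 := by
    intro x hx
    ext t
    rw [hG_def, Set.indicator_of_notMem (fun h => hx ((hmem x t).1 h).1)]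
  -- Fubini
  have hF : Integrable (fun x : Fin 2 → ℝ => ∫ t : ℝ, G (Fin.snoc x t)) :=
    descend_integrable_integral_snoc hG
  have hEq : (fun x : Fin 2 → ℝ => ∫ t : ℝ, G (Fin.snoc x t)) =
      T.indicator (fun q => z.im / (2 * pw q)) := by
    ext x
    by_cases hx : x ∈ T
    · have hpx : 0 < pw x := descend_pw_pos him hx.1 hx.2.1 hx.2.2
      rw [Set.indicator_of_mem hx, hfib_in x hx, integral_indicator measurableSet_Ioo,
        descend_integral_Ioo_id (Real.sqrt_nonneg _), Real.sq_sqrt (div_pos him hpx).le, div_div,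
        mul_comm]
    · rw [Set.indicator_of_notMem hx, hfib_out x hx, integral_zero]
  rw [hEq, integrable_indicator_iff hTm] at hF
  exact hF


/-- The boundary values of the primitive `s²/2`: `β²/2 − 0²/2 = b/(2 pw)`. [folklore] -/
theorem descend_boundary_eq {b pw : ℝ} (hb : 0 < b) (hpw : 0 < pw) :
    Real.sqrt (b / pw) ^ 2 / 2 - (0 : ℝ) ^ 2 / 2 = b / (2 * pw) := by
  rw [Real.sq_sqrt (div_pos hb hpw).le]
  field_simp
  ring

/-- **The descent, explicit form.** For algebraic `z` with `Im z > 0` and any representation `m` on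
the open solid `S(z)` with integrand `s`: a flat-shadow representation `[Δ(z), b/(2 pw)]` exists, and
every such representation is KZ-equivalent to `m` (null modification of the domain to the closed
band, one Newton–Leibniz move with primitive `s²/2`, integrand congruence).
[cite: KontsevichZagier2001, §1.2 rules (1), (3)] -/
theorem descend_core {z : ℂ} (hz : IsAlgebraic ℚ z) (him : 0 < z.im) (m : KZ.IntegralRep 3)
    (hm : m.domain = {p | 0 < p 1 ∧ z.re * p 1 < z.im * p 0 ∧ z.im * (p 0 - 1) < (z.re - 1) * p 1 ∧
      0 < p 2 ∧ (z.im * (p 0 - p 0 ^ 2 - p 1 ^ 2) + (Complex.normSq z - z.re) * p 1) * p 2 ^ 2 < z.im})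
    (hmi : EqOn m.integrand (fun p => p 2) m.domain) :
    (∃ s : KZ.IntegralRep 2,
      s.domain = {q : Fin 2 → ℝ | 0 < q 1 ∧ z.re * q 1 < z.im * q 0 ∧ z.im * (q 0 - 1) < (z.re - 1) * q 1} ∧
      EqOn s.integrand (fun q => z.im /
        (2 * (z.im * (q 0 - q 0 ^ 2 - q 1 ^ 2) + (Complex.normSq z - z.re) * q 1))) s.domain) ∧
    ∀ s : KZ.IntegralRep 2,
      s.domain = {q : Fin 2 → ℝ | 0 < q 1 ∧ z.re * q 1 < z.im * q 0 ∧ z.im * (q 0 - 1) < (z.re - 1) * q 1} →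
      EqOn s.integrand (fun q => z.im /
        (2 * (z.im * (q 0 - q 0 ^ 2 - q 1 ^ 2) + (Complex.normSq z - z.re) * q 1))) s.domain →
      KZ.Equivalent m s := by
  set T : Set (Fin 2 → ℝ) :=
    {q | 0 < q 1 ∧ z.re * q 1 < z.im * q 0 ∧ z.im * (q 0 - 1) < (z.re - 1) * q 1} with hT
  set Φ : (Fin 2 → ℝ) → ℝ := fun q => z.im /
    (2 * (z.im * (q 0 - q 0 ^ 2 - q 1 ^ 2) + (Complex.normSq z - z.re) * q 1)) with hΦ
  set pw : (Fin 2 → ℝ) → ℝ :=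
    fun q => z.im * (q 0 - q 0 ^ 2 - q 1 ^ 2) + (Complex.normSq z - z.re) * q 1 with hpw
  set β : (Fin 2 → ℝ) → ℝ := fun q => Real.sqrt (z.im / pw q) with hβ
  -- positivity of `pw` on the triangle
  have hpwT : ∀ q ∈ T, 0 < pw q := fun q hq => descend_pw_pos him hq.1 hq.2.1 hq.2.2
  -- semialgebraic data
  have hTsa : IsSemialgebraic ℚ T := descend_isSemialgebraic_triangle hz
  have hTm : MeasurableSet T := IsSemialgebraic.measurableSet_holds hTsa
  have h0sa : IsSemialgebraicFunOn ℚ T (fun _ => (0 : ℝ)) := by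
    simpa using isSemialgebraicFunOn_ratCast hTsa 0
  have hβsa : IsSemialgebraicFunOn ℚ T β := descend_isSemialgebraicFunOn_beta hz him hTsa subset_rfl
  have hΦsa : IsSemialgebraicFunOn ℚ T Φ := descend_isSemialgebraicFunOn_phi hz him hTsa subset_rfl
  have hband : IsSemialgebraic ℚ (KZlog.band T (fun _ => 0) β) := KZlog.isSemialgebraic_band h0sa hβsa
  have hFsa : IsSemialgebraicFunOn ℚ (KZlog.band T (fun _ => 0) β)
      (fun p : Fin 3 → ℝ => p (Fin.last 2) ^ 2 / 2) :=
    (isSemialgebraicFunOn_aeval hband (C (1 / 2 : ℚ) * X (Fin.last 2) ^ 2)).congr fun p _ => by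
      simp only [map_mul, map_pow, aeval_C, aeval_X, eq_ratCast]
      push_cast
      ring
  have hfsa : IsSemialgebraicFunOn ℚ (KZlog.band T (fun _ => 0) β) (fun p : Fin 3 → ℝ => p (Fin.last 2)) :=
    (isSemialgebraicFunOn_aeval hband (X (Fin.last 2))).congr fun p _ => by simp
  -- the open solid sits inside the closed band, up to two null graphs
  have hsub : m.domain ⊆ KZlog.band T (fun _ => 0) β := by
    intro p hp
    rw [hm] at hp
    obtain ⟨h1, h2, h3, h4, h5⟩ := hp
    have hq : Fin.init p ∈ T := ⟨h1, h2, h3⟩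
    refine ⟨hq, h4.le, ?_⟩
    exact ((descend_lt_sqrt_iff (hpwT _ hq) h4.le).1 h5).le
  have hdiff : KZlog.band T (fun _ => 0) β \ m.domain ⊆
      {p : Fin 3 → ℝ | Fin.init p ∈ T ∧ p (Fin.last 2) = (fun _ : Fin 2 → ℝ => (0 : ℝ)) (Fin.init p)} ∪
      {p | Fin.init p ∈ T ∧ p (Fin.last 2) = β (Fin.init p)} := by
    rintro p ⟨⟨hq, h0, hb⟩, hnot⟩
    rw [hm] at hnot
    by_cases h2 : p (Fin.last 2) = 0
    · exact Or.inl ⟨hq, h2⟩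
    · right
      refine ⟨hq, le_antisymm hb ?_⟩
      have hpos : 0 < p (Fin.last 2) := lt_of_le_of_ne h0 (Ne.symm h2)
      rw [← descend_sqrt_le_iff (hpwT _ hq) h0]
      by_contra hlt
      push Not at hlt
      exact hnot ⟨hq.1, hq.2.1, hq.2.2, hpos, hlt⟩
  have hnull : volume (KZlog.band T (fun _ => 0) β \ m.domain) = 0 :=
    measure_mono_null hdiff
      (measure_union_null (KZ.volume_graph_eq_zero h0sa) (KZ.volume_graph_eq_zero hβsa))
  have hnull' : volume (m.domain \ KZlog.band T (fun _ => 0) β) = 0 := by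
    rw [sdiff_eq_empty.2 hsub, measure_empty]
  -- integrability of `s` on the band (null modification of `m`)
  have hbm : MeasurableSet m.domain := KZ.IntegralRep.measurableSet_domain_holds m
  have hint : IntegrableOn (fun p : Fin 3 → ℝ => p (Fin.last 2)) (KZlog.band T (fun _ => 0) β) := by
    have h1 : IntegrableOn (fun p : Fin 3 → ℝ => p (Fin.last 2)) m.domain :=
      m.integrableOn.congr_fun hmi hbm
    exact h1.congr_set_ae (ae_eq_set.2 ⟨hnull, hnull'⟩)
  -- integrability of the flat density on the triangle (Fubini)
  have hΦint : IntegrableOn Φ T := descend_integrableOn_phi him m hm hmi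
  -- the boundary function of the primitive is the flat density
  have hbdry : ∀ x ∈ T, (Fin.snoc x (β x) : Fin 3 → ℝ) (Fin.last 2) ^ 2 / 2 -
      (Fin.snoc x ((fun _ : Fin 2 → ℝ => (0 : ℝ)) x) : Fin 3 → ℝ) (Fin.last 2) ^ 2 / 2 = Φ x := by
    intro x hx
    simp only [Fin.snoc_last]
    exact descend_boundary_eq him (hpwT x hx)
  have hds : IsSemialgebraicFunOn ℚ T (fun x => (Fin.snoc x (β x) : Fin 3 → ℝ) (Fin.last 2) ^ 2 / 2 -
      (Fin.snoc x ((fun _ : Fin 2 → ℝ => (0 : ℝ)) x) : Fin 3 → ℝ) (Fin.last 2) ^ 2 / 2) :=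
    hΦsa.congr fun x hx => (hbdry x hx).symm
  have hdi : IntegrableOn (fun x => (Fin.snoc x (β x) : Fin 3 → ℝ) (Fin.last 2) ^ 2 / 2 -
      (Fin.snoc x ((fun _ : Fin 2 → ℝ => (0 : ℝ)) x) : Fin 3 → ℝ) (Fin.last 2) ^ 2 / 2) T :=
    hΦint.congr_fun (fun x hx => (hbdry x hx).symm) hTm
  -- rule (3): the packaged Newton–Leibniz move down the closed band
  obtain ⟨rb, rd, hrb, hrbi, hrd, hrdi, hNL⟩ := KZ.exists_band_newtonLeibniz hTsa (fun _ => 0) β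
    h0sa hβsa (fun q _ => Real.sqrt_nonneg _) (fun p => p (Fin.last 2) ^ 2 / 2)
    (fun p => p (Fin.last 2)) hFsa hfsa
    (fun x _ => by
      simp only [Fin.snoc_last]
      exact (by fun_prop : Continuous fun t : ℝ => t ^ 2 / 2).continuousOn)
    (fun x _ t _ => by
      simp only [Fin.snoc_last]
      exact ((hasDerivAt_pow 2 t).div_const 2).congr_deriv (by ring))
    hint hds hdi
  -- rule (1): the open solid versus the closed band
  have e1 : KZ.of m - KZ.of rb ∈ KZ.relations :=
    KZ.of_sub_of_mem_relations_of_null m rb (by rw [hrb]; exact hnull') (by rw [hrb]; exact hnull)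
      (fun p hp => by rw [hrbi]; exact hmi hp.1)
  -- the base representation IS a flat shadow
  have hrdΦ : EqOn rd.integrand Φ rd.domain := fun x hx => by
    rw [hrd] at hx
    rw [hrdi]
    exact hbdry x hx
  refine ⟨⟨rd, hrd, hrdΦ⟩, fun s hs hsi => ?_⟩
  have e3 : KZ.of rd - KZ.of s ∈ KZ.relations :=
    KZ.of_sub_of_mem_relations_of_eqOn (by rw [hs, hrd]) fun x hx =>
      (hrdΦ hx).trans (hsi (by rw [hs]; rw [hrd] at hx; exact hx)).symm
  have : KZ.of m - KZ.of s = (KZ.of m - KZ.of rb) + (KZ.of rb - KZ.of rd) + (KZ.of rd - KZ.of s) := by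
    abel
  show KZ.of m - KZ.of s ∈ KZ.relations
  rw [this]
  exact add_mem (add_mem e1 hNL) e3

/-- **STUB `stub_descend`** (rule 3: descend to the triangle). For algebraic `z` with `Im z > 0`,
Newton–Leibniz along the last coordinate over the open triangle `Δ(z)` with fibre bounds
`0 ≤ s ≤ (Im z / pw_z(q))^{1/2}` (semialgebraic; `pw_z > 0` on `Δ(z)`) and the polynomial primitive `s²/2`
is one move from the closed band to the flat shadow `[Δ(z), Im z/(2 pw_z)]`; the closed band and the open
solid `S(z)` differ by a null semialgebraic set. Hence every `[S(z), s]` is equivalent to every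
flat-shadow representation, and one exists (integrability of `Im z/(2 pw_z)` on `Δ(z)` by Fubini from
that of `s` on `S(z)`). [cite: KontsevichZagier2001, §1.2 rule (3)] -/
theorem stub_descend : ∀ (S : ℂ → Set (Fin 3 → ℝ)), (∀ z, S z = {p | 0 < p 1 ∧ z.re * p 1 < z.im * p 0 ∧ z.im * (p 0 - 1) < (z.re - 1) * p 1 ∧ 0 < p 2 ∧ (z.im * (p 0 - p 0 ^ 2 - p 1 ^ 2) + (Complex.normSq z - z.re) * p 1) * p 2 ^ 2 < z.im}) → ∀ (Δ : ℂ → Set (Fin 2 → ℝ)), (∀ z, Δ z = {q | 0 < q 1 ∧ z.re * q 1 < z.im * q 0 ∧ z.im * (q 0 - 1) < (z.re - 1) * q 1}) → ∀ (φ : ℂ → (Fin 2 → ℝ) → ℝ), (∀ z q, φ z q = z.im / (2 * (z.im * (q 0 - q 0 ^ 2 - q 1 ^ 2) + (Complex.normSq z - z.re) * q 1))) → ∀ z : ℂ, IsAlgebraic ℚ z → 0 < z.im → ∀ m : Literature.NumberTheory.Transcendental.KZ.IntegralRep 3, m.domain = S z → Set.EqOn m.integrand (fun p => p 2) m.domain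 → (∃ s : Literature.NumberTheory.Transcendental.KZ.IntegralRep 2, s.domain = Δ z ∧ Set.EqOn s.integrand (φ z) s.domain) ∧ (∀ s : Literature.NumberTheory.Transcendental.KZ.IntegralRep 2, s.domain = Δ z → Set.EqOn s.integrand (φ z) s.domain → Literature.NumberTheory.Transcendental.KZ.Equivalent m s) := by
  intro S hS Δ hΔ φ hφ z hz him m hm hmi
  have hS' : S = fun z => {p : Fin 3 → ℝ | 0 < p 1 ∧ z.re * p 1 < z.im * p 0 ∧
      z.im * (p 0 - 1) < (z.re - 1) * p 1 ∧ 0 < p 2 ∧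
      (z.im * (p 0 - p 0 ^ 2 - p 1 ^ 2) + (Complex.normSq z - z.re) * p 1) * p 2 ^ 2 < z.im} := funext hS
  have hΔ' : Δ = fun z => {q : Fin 2 → ℝ | 0 < q 1 ∧ z.re * q 1 < z.im * q 0 ∧
      z.im * (q 0 - 1) < (z.re - 1) * q 1} := funext hΔ
  have hφ' : φ = fun z q => z.im /
      (2 * (z.im * (q 0 - q 0 ^ 2 - q 1 ^ 2) + (Complex.normSq z - z.re) * q 1)) :=
    funext fun z => funext (hφ z)
  subst hS' hΔ' hφ'
  exact descend_core hz him m hm hmi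

end Summit.KontsevichZagierPeriods.HyperbolicBloch.OffTetraSectorKernel

end
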